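import Mathlib.Geometry.Manifold.VectorBundle.Tangent
import Mathlib.Geometry.Manifold.MFDeriv.Basic
import Mathlib.Geometry.Manifold.MFDeriv.SpecificFunctions
import Mathlib.Geometry.Manifold.Diffeomorph
import Mathlib.Geometry.Manifold.Instances.Sphere
import Mathlib.LinearAlgebra.Orientation
import Mathlib.LinearAlgebra.Determinant
import Mathlib.AlgebraicTopology.FundamentalGroupoid.SimplyConnected
import HarnessLib

-- provenance: harness21/H21/H21/Prelude/FourManM/SmoothOrientation.lean @ eed0bef (interim HEAD d8f2665); M5 mechanical rewrite
/-!
# Smooth orientations of manifolds (trunk T-4MAN, prelude `FourManM`)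

An *orientation* of a `C¹` manifold `M` modelled on `I : ModelWithCorners ℝ E H` is a choice, for
every point `x : M`, of an orientation of the model vector space `E` (read: of the tangent space
`T_x M = E` in the preferred chart at `x`), which is *locally constant* in the following sense: for
`y` near `x`, the orientations chosen at `y` and at `x` agree, once both are expressed in the chart
at `x`, i.e. `o y = o x` holds exactly when the derivative at `y` of the chart change from the chart
at `y` to the chart at `x` (Mathlib's `tangentCoordChange I y x y`) has positive determinant. This is
the classical definition of an orientation as a "consistent family of orientations of the tangent
spaces" (Hirsch, *Differential Topology*, §4.4; Milnor–Stasheff, *Characteristic classes*, p. 122;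
Lee, *Introduction to Smooth Manifolds*, Ch. 15, "pointwise continuous orientation").

## Main definitions

* `Literature.SmoothOrientation I M`: the structure of smooth orientations of `M`; a `FunLike` into
  `Orientation ℝ E (Fin (Module.finrank ℝ E))`, with the opposite orientation `-o = o.neg`.
* `Literature.SmoothOrientation.modelSpace o`: the constant orientation of the model vector space `E`.
* `Literature.euclideanOrientation n`, `Literature.SmoothOrientation.euclidean n`: the standard orientation of
  `EuclideanSpace ℝ (Fin n)` (from its standard orthonormal basis) and the induced smooth orientation.
* `Literature.IsOrientable I M`: `M` admits a smooth orientation.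
* `Literature.IsOrientationPreserving oM oN f`, `Literature.IsOrientationReversing oM oN f`: a map `f : M → N`
  between oriented manifolds modelled on the *same* vector space `E` (the models `I`, `I'` may differ,
  e.g. `𝓡 n` and `𝓡∂ n`) preserves / reverses the orientations, expressed through the sign of
  `det (mfderiv I I' f x)`; `Diffeomorph.IsOrientationPreserving` is the dot-notation abbreviation
  (deliberately placed in Mathlib's `Diffeomorph` namespace).

## Main statements (sorried, known results)

* `Literature.Topology.FourManifolds.SmoothOrientation.eq_or_eq_neg_of_connectedSpace`: a connected orientable manifold has exactly
  two orientations (Hirsch §4.4, Thm 4.3).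
* `Literature.Topology.FourManifolds.isOrientable_sphere`: spheres are orientable.
* `Literature.Topology.FourManifolds.isOrientable_of_simplyConnectedSpace`: simply connected manifolds are orientable (orientation
  double cover; Hirsch §4.4, Lee Thm 15.40).
* `Literature.Topology.FourManifolds.exists_diffeomorph_isOrientationReversing_sphere`: `𝕊ⁿ` carries an orientation-reversing
  self-diffeomorphism (a reflection).

## Mathlib status and design choices

* Mathlib has `Orientation R M ι` (orientations of a module, `LinearAlgebra/Orientation.lean`, with
  `Orientation.map_eq_iff_det_pos`) and the tangent-bundle coordinate changes `tangentCoordChange`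
  (`Geometry/Manifold/VectorBundle/Tangent.lean`), but **no** notion of orientation or orientability
  of a manifold (`rg -i 'orientable|OrientationPreserving' Mathlib/Geometry/Manifold` only hits doc
  comments). Everything below is therefore new.
* (Outline D4.) We index orientations by `Fin (Module.finrank ℝ E)` and only assume
  `[IsManifold I 1 M]`; the definition works verbatim for models with boundary or corners (same `E`)
  and avoids introducing a new orientation-preserving `Pregroupoid`/`StructureGroupoid`.
* `IsOrientationPreserving` is phrased pointwise as an `↔` with `0 < det (mfderiv f x)`; this is the
  intended notion for local diffeomorphisms (the only use downstream). For maps whose differential is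
  somewhere singular the predicate is *not* the naive one (at such points it forces
  `oN (f x) = -oM x`); this is documented on the definition, and the composition lemma accordingly
  assumes invertible differentials.
* Product and boundary orientations are **not** provided here: the index types
  `Fin (finrank (E × F))` vs `Fin (finrank E) ⊕ Fin (finrank F)` and the boundary model differ, and the
  natural constructions need collars; they are deferred to the L wave (`gluing_along_boundary`).

Sources: M. W. Hirsch, *Differential Topology* (GTM 33, 1976), §4.4; J. Milnor, J. Stasheff,
*Characteristic Classes* (1974), §11–12; J. M. Lee, *Introduction to Smooth Manifolds* (2nd ed.,
2013), Ch. 15; outline `H21/Outlines/FourManM.md` §1 (D4), §2 (C2).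
-/

open scoped Manifold ContDiff Topology
open Set Module

noncomputable section

namespace Literature.Topology.FourManifolds

/-- Local notation: `𝔼 n` is the model Euclidean space `EuclideanSpace ℝ (Fin n)`. -/
local notation "𝔼 " n:arg => EuclideanSpace ℝ (Fin n)

/-- Local notation: `𝕊 n` is the unit sphere in `EuclideanSpace ℝ (Fin (n + 1))`, the standard
`n`-sphere with its Mathlib analytic manifold structure. -/
local notation "𝕊 " n:arg => (Metric.sphere (0 : EuclideanSpace ℝ (Fin (n + 1))) 1)

/-! ### The structure of smooth orientations -/

/-- A **smooth orientation** of a `C¹` manifold `M` modelled on `I : ModelWithCorners ℝ E H`: a family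
`toFun : M → Orientation ℝ E (Fin (finrank ℝ E))` of orientations of the model space (i.e. of the
tangent spaces `T_x M`, identified with `E` through the preferred chart at each point), which is
locally constant when read in a fixed chart: for `y` near `x`, `toFun y = toFun x` iff the derivative
at `y` of the change of charts from the chart at `y` to the chart at `x`,
`tangentCoordChange I y x y : E →L[ℝ] E`, has positive determinant (equivalently, by
`Orientation.map_eq_iff_det_pos`, iff transporting `toFun y` along it gives `toFun x`).
Hirsch, *Differential Topology*, §4.4; Lee, *Introduction to Smooth Manifolds*, Ch. 15. [folklore] -/
structure SmoothOrientation {E H : Type*} [NormedAddCommGroup E] [NormedSpace ℝ E]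
    [TopologicalSpace H] (I : ModelWithCorners ℝ E H)
    (M : Type*) [TopologicalSpace M] [ChartedSpace H M] [IsManifold I 1 M] where
  /-- The orientation of the tangent space at each point, read in the preferred chart there. -/
  toFun : M → Orientation ℝ E (Fin (finrank ℝ E))
  /-- Local constancy: near `x`, the orientation at `y` agrees with the one at `x` iff the chart
  change `y → x` has positive Jacobian determinant at `y`. -/
  eventually_eq_iff' : ∀ x : M, ∀ᶠ y in 𝓝 x,
    (toFun y = toFun x ↔
      0 < LinearMap.det ((tangentCoordChange I y x y : E →L[ℝ] E) : E →ₗ[ℝ] E))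

section General

variable {E H : Type*} [NormedAddCommGroup E] [NormedSpace ℝ E] [TopologicalSpace H]
  {I : ModelWithCorners ℝ E H}
  {M : Type*} [TopologicalSpace M] [ChartedSpace H M] [IsManifold I 1 M]

namespace SmoothOrientation

/-- A smooth orientation is a function from `M` to orientations of the model space
(Hirsch, *Differential Topology*, §4.4). [folklore] -/
instance instFunLike : FunLike (SmoothOrientation I M) M (Orientation ℝ E (Fin (finrank ℝ E))) where
  coe := SmoothOrientation.toFun
  coe_injective o o' h := by cases o; cases o'; congr

/-- Two smooth orientations are equal iff they agree at every point (Hirsch §4.4). [folklore] -/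
@[ext] theorem ext {o o' : SmoothOrientation I M} (h : ∀ x, o x = o' x) : o = o' :=
  DFunLike.ext o o' h

/-- Simp-normal form: the field `toFun` is the coercion (Hirsch §4.4). [folklore] -/
@[simp] theorem toFun_eq_coe (o : SmoothOrientation I M) : o.toFun = ⇑o := rfl

/-- The defining local-constancy property of a smooth orientation, stated with the coercion:
near `x`, `o y = o x` iff the chart change `y → x` has positive Jacobian at `y`
(Hirsch, *Differential Topology*, §4.4). [folklore] -/
theorem eventually_eq_iff (o : SmoothOrientation I M) (x : M) :
    ∀ᶠ y in 𝓝 x, (o y = o x ↔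
      0 < LinearMap.det ((tangentCoordChange I y x y : E →L[ℝ] E) : E →ₗ[ℝ] E)) :=
  o.eventually_eq_iff' x

/-- The **opposite orientation** `-o`: reverse the orientation of every tangent space. It is again
locally constant since `-a = -b ↔ a = b` (Hirsch, *Differential Topology*, §4.4). [folklore] -/
protected def neg (o : SmoothOrientation I M) : SmoothOrientation I M where
  toFun x := -o x
  eventually_eq_iff' x := by
    filter_upwards [o.eventually_eq_iff x] with y hy
    rw [← hy]
    exact neg_inj (a := o y) (b := o x)

/-- Notation `-o` for the opposite orientation `o.neg` (Hirsch §4.4). [folklore] -/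
instance instNeg : Neg (SmoothOrientation I M) := ⟨SmoothOrientation.neg⟩

/-- `o.neg` is `-o` (Hirsch §4.4). [folklore] -/
@[simp] theorem neg_def (o : SmoothOrientation I M) : o.neg = -o := rfl

/-- The opposite orientation is pointwise the opposite orientation of the tangent space
(Hirsch §4.4). [folklore] -/
@[simp] theorem neg_apply (o : SmoothOrientation I M) (x : M) : (-o) x = -o x := rfl

/-- Reversing an orientation twice gives it back (Hirsch, *Differential Topology*, §4.4). [folklore] -/
protected theorem neg_neg (o : SmoothOrientation I M) : - -o = o := by
  ext x
  exact _root_.neg_neg (o x)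

/-- Negation of smooth orientations is involutive (Hirsch §4.4). [folklore] -/
instance instInvolutiveNeg : InvolutiveNeg (SmoothOrientation I M) where
  neg_neg := SmoothOrientation.neg_neg

/-- On a nonempty manifold an orientation differs from its opposite
(`Module.Ray.ne_neg_self`; Hirsch, *Differential Topology*, §4.4). No positivity assumption on the
dimension is needed: a `0`-dimensional vector space also has exactly two orientations `±1`. [folklore] -/
theorem ne_neg_self [Nonempty M] (o : SmoothOrientation I M) : o ≠ -o := by
  intro h
  obtain ⟨x⟩ := ‹Nonempty M›
  have hx := congrArg (fun o : SmoothOrientation I M => o x) h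
  exact Module.Ray.ne_neg_self (o x) (by simpa using hx)

end SmoothOrientation

/-- A `C¹` manifold is **orientable** if it admits a smooth orientation
(Hirsch, *Differential Topology*, §4.4). [folklore] -/
def IsOrientable (I : ModelWithCorners ℝ E H) (M : Type*) [TopologicalSpace M] [ChartedSpace H M]
    [IsManifold I 1 M] : Prop :=
  Nonempty (SmoothOrientation I M)

/-- On a connected manifold two orientations are either equal or opposite: the set where they agree
is open (local constancy) and so is the set where they differ (Hirsch, *Differential Topology*,
§4.4, Thm 4.3; Lee, *Introduction to Smooth Manifolds*, Prop. 15.9). [cite: HirschDT1976, §4.4 Thm. 4.3; Lee Prop. 15.9] -/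
def SmoothOrientation.eq_or_eq_neg_of_connectedSpace : Prop :=
  ∀ [ConnectedSpace M] (o o' : SmoothOrientation I M),
    o' = o ∨ o' = -o

/-- A simply connected manifold is orientable: the orientation double cover of `M` is a covering
space, hence trivial over a simply connected (locally path connected — charts are modelled on the
convex set `range I`) base, and a sheet is an orientation (Hirsch, *Differential Topology*, §4.4,
Thm 4.4 ff.; Lee, *Introduction to Smooth Manifolds*, Thm 15.40). [cite: LeeSmoothManifolds2013, Thm. 15.40; Hirsch §4.4] -/
def isOrientable_of_simplyConnectedSpace : Prop :=
  ∀ [SimplyConnectedSpace M],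
    IsOrientable I M

/-- An orientation `o` of `M` together with its opposite exhaust the orientations of a connected
manifold; phrased on `IsOrientable`: an orientable nonempty connected manifold has exactly two
orientations (Hirsch, *Differential Topology*, §4.4, Thm 4.3). [folklore] -/
def SmoothOrientation.eq_neg_iff_ne_of_connectedSpace : Prop :=
  ∀ [ConnectedSpace M] [Nonempty M] (o o' : SmoothOrientation I M),
    o' = -o ↔ o' ≠ o

/- interim proof relied on results that are now named facts (D-0014); demoted to a fact by the M5 import, proof preserved:
:= by
  refine ⟨fun h h' => o.ne_neg_self (h'.symm.trans h), fun h => ?_⟩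
  exact (o.eq_or_eq_neg_of_connectedSpace o').resolve_left h
-/

/-! ### The model vector space -/

/-- The **constant orientation** of the model vector space `E` (as a manifold modelled on itself,
`𝓘(ℝ, E)`) with value `o : Orientation ℝ E _`: all charts are the identity, so the chart changes are
`tangentCoordChange 𝓘(ℝ, E) y x y = id` (`tangentCoordChange_self`) with determinant `1 > 0`
(Hirsch, *Differential Topology*, §4.4, Example). [folklore] -/
def SmoothOrientation.modelSpace (o : Orientation ℝ E (Fin (finrank ℝ E))) :
    SmoothOrientation 𝓘(ℝ, E) E where
  toFun _ := o
  eventually_eq_iff' x := by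
    filter_upwards with y
    have : tangentCoordChange 𝓘(ℝ, E) y x y = ContinuousLinearMap.id ℝ E := by
      ext v
      exact tangentCoordChange_self (by simp)
    rw [this]
    simp

/-- The constant orientation of the model space takes the value `o` everywhere (Hirsch §4.4). [folklore] -/
@[simp] theorem SmoothOrientation.modelSpace_apply (o : Orientation ℝ E (Fin (finrank ℝ E))) (x : E) :
    SmoothOrientation.modelSpace o x = o := rfl

/-- The opposite of the constant orientation `o` of `E` is the constant orientation `-o`
(Hirsch §4.4). [folklore] -/
@[simp] theorem SmoothOrientation.neg_modelSpace (o : Orientation ℝ E (Fin (finrank ℝ E))) :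
    -SmoothOrientation.modelSpace o = SmoothOrientation.modelSpace (-o) := rfl

/-! ### Orientation-preserving and orientation-reversing maps -/

variable {H' : Type*} [TopologicalSpace H'] {I' : ModelWithCorners ℝ E H'}
  {N : Type*} [TopologicalSpace N] [ChartedSpace H' N] [IsManifold I' 1 N]
  {H'' : Type*} [TopologicalSpace H''] {I'' : ModelWithCorners ℝ E H''}
  {P : Type*} [TopologicalSpace P] [ChartedSpace H'' P] [IsManifold I'' 1 P]

/-- A map `f : M → N` between oriented manifolds modelled on the **same** vector space `E` (the
models with corners `I`, `I'` may differ, e.g. `𝓡 n` and `𝓡∂ n` for the inclusion of a boundary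
collar) is **orientation preserving** if at every point `x`, the orientation `oN (f x)` agrees with
`oM x` exactly when the differential `mfderiv I I' f x : E →L[ℝ] E` (in the preferred charts at `x`
and `f x`) has positive determinant. For a local diffeomorphism this is the classical notion "the
differential carries `oM x` to `oN (f x)`" (`Orientation.map_eq_iff_det_pos`); at points where the
differential is singular the predicate forces `oN (f x) = -oM x`, so it should only be used for local
diffeomorphisms (Hirsch, *Differential Topology*, §4.4; Lee, *Introduction to Smooth Manifolds*,
p. 383). [folklore] -/
def IsOrientationPreserving (oM : SmoothOrientation I M) (oN : SmoothOrientation I' N) (f : M → N) :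
    Prop :=
  ∀ x, (oN (f x) = oM x ↔ 0 < LinearMap.det (M := E) (mfderiv I I' f x).toLinearMap)

/-- A map `f : M → N` between oriented manifolds modelled on the same vector space is **orientation
reversing** if it is orientation preserving towards the opposite orientation `-oN` of the target
(Hirsch, *Differential Topology*, §4.4). [folklore] -/
def IsOrientationReversing (oM : SmoothOrientation I M) (oN : SmoothOrientation I' N) (f : M → N) :
    Prop :=
  IsOrientationPreserving oM (-oN) f

/-- Unfolding lemma for `IsOrientationReversing` (Hirsch §4.4). [folklore] -/
theorem isOrientationReversing_iff (oM : SmoothOrientation I M) (oN : SmoothOrientation I' N)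
    (f : M → N) : IsOrientationReversing oM oN f ↔ IsOrientationPreserving oM (-oN) f :=
  Iff.rfl

/-- `f` reverses the orientations `oM`, `oN` iff it preserves the orientations `-oM`, `oN`: negating
the source orientation instead of the target one gives the same notion (Hirsch §4.4). [folklore] -/
theorem isOrientationReversing_iff_neg (oM : SmoothOrientation I M) (oN : SmoothOrientation I' N)
    (f : M → N) : IsOrientationReversing oM oN f ↔ IsOrientationPreserving (-oM) oN f := by
  refine forall_congr' fun x => iff_congr ?_ Iff.rfl
  exact neg_eq_iff_eq_neg (a := oN (f x)) (b := oM x)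

/-- `f` preserves `oM`, `-oN` iff it reverses `oM`, `oN`; and preserving `-oM`, `-oN` is the same as
preserving `oM`, `oN` (Hirsch §4.4). [folklore] -/
@[simp] theorem isOrientationPreserving_neg_neg_iff (oM : SmoothOrientation I M)
    (oN : SmoothOrientation I' N) (f : M → N) :
    IsOrientationPreserving (-oM) (-oN) f ↔ IsOrientationPreserving oM oN f := by
  refine forall_congr' fun x => iff_congr ?_ Iff.rfl
  exact neg_inj (a := oN (f x)) (b := oM x)

/-- The identity map preserves every orientation: `mfderiv id = id` has determinant `1`
(Hirsch, *Differential Topology*, §4.4). [folklore] -/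
theorem isOrientationPreserving_id (o : SmoothOrientation I M) : IsOrientationPreserving o o id := by
  intro x
  simp only [id_eq, true_iff, mfderiv_id]
  exact lt_of_lt_of_eq zero_lt_one LinearMap.det_id.symm

/-- Composition of orientation-preserving maps with everywhere invertible differentials is
orientation preserving (chain rule `mfderiv (g ∘ f) x = mfderiv g (f x) ∘ mfderiv f x` and
multiplicativity of `det`). The invertibility hypotheses are needed because of the pointwise `↔`
phrasing of `IsOrientationPreserving`, see there (Hirsch, *Differential Topology*, §4.4). [cite: HirschDT1976, §4.4] -/
def IsOrientationPreserving.comp : Prop :=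
  ∀ {oM : SmoothOrientation I M} {oN : SmoothOrientation I' N} {oP : SmoothOrientation I'' P} {g : N → P} {f : M → N} (hg : IsOrientationPreserving oN oP g) (hf : IsOrientationPreserving oM oN f) (hgd : MDifferentiable I' I'' g) (hfd : MDifferentiable I I' f) (hg' : ∀ y, LinearMap.det (M := E) (mfderiv I' I'' g y).toLinearMap ≠ 0) (hf' : ∀ x, LinearMap.det (M := E) (mfderiv I I' f x).toLinearMap ≠ 0),
    IsOrientationPreserving oM oP (g ∘ f)

end General

/-! ### Diffeomorphisms (dot notation in Mathlib's `Diffeomorph` namespace) -/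

section Diffeomorph

variable {E H H' H'' : Type*} [NormedAddCommGroup E] [NormedSpace ℝ E] [TopologicalSpace H]
  [TopologicalSpace H'] [TopologicalSpace H''] {I : ModelWithCorners ℝ E H}
  {I' : ModelWithCorners ℝ E H'} {I'' : ModelWithCorners ℝ E H''}
  {M : Type*} [TopologicalSpace M] [ChartedSpace H M] [IsManifold I 1 M]
  {N : Type*} [TopologicalSpace N] [ChartedSpace H' N] [IsManifold I' 1 N]
  {P : Type*} [TopologicalSpace P] [ChartedSpace H'' P] [IsManifold I'' 1 P] {n : WithTop ℕ∞}

/-- A `Cⁿ` diffeomorphism `φ : M ≃ₘ^n⟮I, I'⟯ N` between oriented manifolds (same model vector space)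
is **orientation preserving** if its underlying map is (`Literature.Topology.FourManifolds.IsOrientationPreserving`). Declared in
Mathlib's `Diffeomorph` namespace on purpose, for dot notation `φ.IsOrientationPreserving oM oN`
(Hirsch, *Differential Topology*, §4.4). [folklore] -/
abbrev _root_.Diffeomorph.IsOrientationPreserving (φ : M ≃ₘ^n⟮I, I'⟯ N) (oM : SmoothOrientation I M)
    (oN : SmoothOrientation I' N) : Prop :=
  Literature.Topology.FourManifolds.IsOrientationPreserving oM oN φ

/-- A `Cⁿ` diffeomorphism is **orientation reversing** if its underlying map is
(`Literature.Topology.FourManifolds.IsOrientationReversing`); dot notation in Mathlib's `Diffeomorph` namespace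
(Hirsch, *Differential Topology*, §4.4). [folklore] -/
abbrev _root_.Diffeomorph.IsOrientationReversing (φ : M ≃ₘ^n⟮I, I'⟯ N) (oM : SmoothOrientation I M)
    (oN : SmoothOrientation I' N) : Prop :=
  Literature.Topology.FourManifolds.IsOrientationReversing oM oN φ

/-- The identity diffeomorphism preserves every orientation (Hirsch §4.4). [folklore] -/
theorem _root_.Diffeomorph.isOrientationPreserving_refl (o : SmoothOrientation I M) :
    (Diffeomorph.refl I M n).IsOrientationPreserving o o :=
  isOrientationPreserving_id o

/-- Orientation-preserving `Cⁿ` diffeomorphisms (`n ≠ 0`) compose (Hirsch, *Differential Topology*,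
§4.4; special case of `Literature.Topology.FourManifolds.IsOrientationPreserving.comp`, differentials of diffeomorphisms being
invertible). [cite: HirschDT1976, §4.4] -/
def _root_.Diffeomorph.IsOrientationPreserving.trans : Prop :=
  ∀ {φ : M ≃ₘ^n⟮I, I'⟯ N} {ψ : N ≃ₘ^n⟮I', I''⟯ P} {oM : SmoothOrientation I M} {oN : SmoothOrientation I' N} {oP : SmoothOrientation I'' P} (hφ : φ.IsOrientationPreserving oM oN) (hψ : ψ.IsOrientationPreserving oN oP) (hn : n ≠ 0),
    (φ.trans ψ).IsOrientationPreserving oM oP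

/-- The inverse of an orientation-preserving `Cⁿ` diffeomorphism (`n ≠ 0`) is orientation preserving
(Hirsch, *Differential Topology*, §4.4). [cite: HirschDT1976, §4.4] -/
def _root_.Diffeomorph.IsOrientationPreserving.symm : Prop :=
  ∀ {φ : M ≃ₘ^n⟮I, I'⟯ N} {oM : SmoothOrientation I M} {oN : SmoothOrientation I' N} (hφ : φ.IsOrientationPreserving oM oN) (hn : n ≠ 0),
    φ.symm.IsOrientationPreserving oN oM

/-- A diffeomorphism from a nonempty connected oriented manifold either preserves or reverses the
orientations: the pulled-back orientation `x ↦ (dφ_x)⁻¹ (oN (φ x))` is `oM` or `-oM`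
(Hirsch, *Differential Topology*, §4.4). [cite: HirschDT1976, §4.4] -/
def _root_.Diffeomorph.isOrientationPreserving_or_isOrientationReversing : Prop :=
  ∀ [ConnectedSpace M] (φ : M ≃ₘ^n⟮I, I'⟯ N) (hn : n ≠ 0) (oM : SmoothOrientation I M) (oN : SmoothOrientation I' N),
    φ.IsOrientationPreserving oM oN ∨ φ.IsOrientationReversing oM oN

end Diffeomorph

/-! ### Euclidean spaces and spheres -/

section Euclidean

/-- The **standard orientation** of `EuclideanSpace ℝ (Fin n)`: the orientation of its standard
orthonormal basis `EuclideanSpace.basisFun`, reindexed by `Fin n ≃ Fin (finrank ℝ (𝔼 n))`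
(`finrank_euclideanSpace_fin`) to match the index convention of `SmoothOrientation`
(Milnor–Stasheff, *Characteristic Classes*, p. 122). [folklore] -/
def euclideanOrientation (n : ℕ) : Orientation ℝ (𝔼 n) (Fin (finrank ℝ (𝔼 n))) :=
  ((EuclideanSpace.basisFun (Fin n) ℝ).toBasis.reindex
    (finCongr finrank_euclideanSpace_fin.symm)).orientation

/-- The **standard smooth orientation** of `EuclideanSpace ℝ (Fin n)` as a manifold modelled on
itself: the constant orientation with value `euclideanOrientation n` (Hirsch §4.4). [folklore] -/
def SmoothOrientation.euclidean (n : ℕ) : SmoothOrientation 𝓘(ℝ, 𝔼 n) (𝔼 n) :=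
  SmoothOrientation.modelSpace (euclideanOrientation n)

/-- The standard smooth orientation of `𝔼 n` takes the value `euclideanOrientation n` everywhere
(Hirsch §4.4). [folklore] -/
@[simp] theorem SmoothOrientation.euclidean_apply (n : ℕ) (x : 𝔼 n) :
    SmoothOrientation.euclidean n x = euclideanOrientation n := rfl

/-- Euclidean space `𝔼 n` is orientable (Hirsch, *Differential Topology*, §4.4). [folklore] -/
theorem isOrientable_euclideanSpace (n : ℕ) : IsOrientable 𝓘(ℝ, 𝔼 n) (𝔼 n) :=
  ⟨SmoothOrientation.euclidean n⟩

/-- The sphere `𝕊ⁿ ⊂ ℝⁿ⁺¹` is orientable, e.g. as the boundary of the ball, or because the two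
stereographic charts have orientation-reversing transition `x ↦ x / ‖x‖²` on the connected (for
`n ≥ 2`) overlap, so flipping one chart gives an oriented atlas; `n = 0, 1` by hand
(Hirsch, *Differential Topology*, §4.4, Ex.; Milnor–Stasheff, *Characteristic Classes*, §11). [cite: HirschDT1976, §4.4 (exercises); Milnor–Stasheff §11] -/
def isOrientable_sphere : Prop :=
  ∀ (n : ℕ),
    IsOrientable (𝓡 n) (𝕊 n)

/-- Every orientation of the sphere `𝕊ⁿ`, `n ≥ 1`, is reversed by some self-diffeomorphism, namely
by the reflection `x ↦ (-x₀, x₁, …, xₙ)` in a coordinate hyperplane (`𝕊ⁿ` is connected, so `o` is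
`±` the standard orientation). The hypothesis `n ≠ 0` is necessary: `𝕊⁰` (two points) with the
orientation `(+, +)` has no orientation-reversing self-map (Hirsch, *Differential Topology*, §4.4;
Milnor, *Topology from the Differentiable Viewpoint*, §6). [cite: HirschDT1976, §4.4; Milnor TFDV §6] -/
def exists_diffeomorph_isOrientationReversing_sphere : Prop :=
  ∀ (n : ℕ) (hn : n ≠ 0) (o : SmoothOrientation (𝓡 n) (𝕊 n)),
    ∃ φ : (𝕊 n) ≃ₘ⟮𝓡 n, 𝓡 n⟯ (𝕊 n), φ.IsOrientationReversing o o

end Euclidean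

end Literature.Topology.FourManifolds

/-! ### Discharged facts -/

namespace Literature.Topology.FourManifolds

section CompHolds

variable {E H : Type*} [NormedAddCommGroup E] [NormedSpace ℝ E] [TopologicalSpace H]
  {I : ModelWithCorners ℝ E H}
  {M : Type*} [TopologicalSpace M] [ChartedSpace H M] [IsManifold I 1 M]
  {H' : Type*} [TopologicalSpace H'] {I' : ModelWithCorners ℝ E H'}
  {N : Type*} [TopologicalSpace N] [ChartedSpace H' N] [IsManifold I' 1 N]
  {H'' : Type*} [TopologicalSpace H''] {I'' : ModelWithCorners ℝ E H''}
  {P : Type*} [TopologicalSpace P] [ChartedSpace H'' P] [IsManifold I'' 1 P]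

/-- Two orientations of `E` indexed by `Fin (finrank ℝ E)` are equal or opposite, provided some
endomorphism of `E` has determinant `≠ 1` (which forces `E` to be finite-dimensional, as
`LinearMap.det` is `1` by convention otherwise); Hirsch, *Differential Topology*, §4.4, p. 100
("each fibre has exactly two orientations"). [cite: HirschDT1976, §4.4 p. 100] -/
theorem orientation_eq_or_eq_neg_of_det_ne_one {u : E →ₗ[ℝ] E} (hu : LinearMap.det u ≠ 1)
    (x₁ x₂ : Orientation ℝ E (Fin (finrank ℝ E))) : x₁ = x₂ ∨ x₁ = -x₂ := by
  have : Module.Finite ℝ E := by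
    by_contra h
    exact hu (LinearMap.det_eq_one_of_not_module_finite h u)
  exact Orientation.eq_or_eq_neg x₁ x₂ (Fintype.card_fin _)

/-- **Discharge** of `Literature.Topology.FourManifolds.IsOrientationPreserving.comp`: orientation-preserving maps with everywhere
invertible differentials compose. Proof: chain rule `mfderiv (g ∘ f) x = mfderiv g (f x) ∘ mfderiv f x`
(`mfderiv_comp`), multiplicativity `det (A ∘ B) = det A * det B` (`LinearMap.det_comp`), and a sign
case split; the case of two negative Jacobians uses that a fibre has exactly two orientations.
This is Hirsch's remark that `f` preserves orientation iff its derivative in oriented charts has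
positive Jacobian, so that orientation-preserving diffeomorphisms form a group `Diff₊`
(Hirsch, *Differential Topology*, §4.4, p. 101 and Ex. 12, p. 104). [cite: HirschDT1976, §4.4 p. 101; Ex. 12 p. 104] -/
theorem IsOrientationPreserving.comp_holds :
    IsOrientationPreserving.comp (I := I) (M := M) (I' := I') (N := N) (I'' := I'') (P := P) := by
  intro oM oN oP g f hg hf hgd hfd hg' hf' x
  have hchain : mfderiv I I'' (g ∘ f) x = (mfderiv I' I'' g (f x)).comp (mfderiv I I' f x) :=
    mfderiv_comp x (hgd (f x)) (hfd x)
  set a := LinearMap.det (M := E) (mfderiv I' I'' g (f x)).toLinearMap with ha_def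
  set b := LinearMap.det (M := E) (mfderiv I I' f x).toLinearMap with hb_def
  have hdet : LinearMap.det (M := E) (mfderiv I I'' (g ∘ f) x).toLinearMap = a * b := by
    rw [hchain]
    exact LinearMap.det_comp (M := E) (mfderiv I' I'' g (f x)).toLinearMap
      (mfderiv I I' f x).toLinearMap
  have hfx : oN (f x) = oM x ↔ 0 < b := hf x
  have hgx : oP (g (f x)) = oN (f x) ↔ 0 < a := hg (f x)
  have hb0 : b ≠ 0 := hf' x
  have ha0 : a ≠ 0 := hg' (f x)
  show oP (g (f x)) = oM x ↔ 0 < LinearMap.det (M := E) (mfderiv I I'' (g ∘ f) x).toLinearMap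
  rw [hdet]
  rcases lt_or_gt_of_ne hb0 with hb | hb
  · -- `b < 0`: `oN (f x) ≠ oM x`
    have hN : oN (f x) ≠ oM x := fun h => (lt_asymm hb) (hfx.mp h)
    rcases lt_or_gt_of_ne ha0 with ha | ha
    · -- `a < 0`: `oP (g (f x)) ≠ oN (f x)`, hence `= oM x` (two orientations)
      have hP : oP (g (f x)) ≠ oN (f x) := fun h => (lt_asymm ha) (hgx.mp h)
      have hb1 : b ≠ 1 := (hb.trans one_pos).ne
      have h2 := orientation_eq_or_eq_neg_of_det_ne_one hb1
      have e1 : oP (g (f x)) = -oN (f x) := (h2 _ _).resolve_left hP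
      have e2 : oN (f x) = -oM x := (h2 _ _).resolve_left hN
      refine ⟨fun _ => mul_pos_of_neg_of_neg ha hb, fun _ => ?_⟩
      rw [e1, e2]
      exact _root_.neg_neg (oM x)
    · -- `0 < a`: `oP (g (f x)) = oN (f x) ≠ oM x`, product negative
      have hP : oP (g (f x)) = oN (f x) := hgx.mpr ha
      refine ⟨fun h => absurd (hP.symm.trans h) hN, fun h => ?_⟩
      exact absurd h (not_lt.mpr (mul_nonpos_of_nonneg_of_nonpos ha.le hb.le))
  · -- `0 < b`: `oN (f x) = oM x`
    have hN : oN (f x) = oM x := hfx.mpr hb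
    rw [← hN, hgx]
    exact (mul_pos_iff_of_pos_right hb).symm

end CompHolds

end Literature.Topology.FourManifolds
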